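import Literature.MathematicalPhysics.QuantumFieldTheory.Balaban1983to89.B7BlockAvgLog

/-!
# T⁴ programme, spine estimate NE1′ (node O3b/H2) — ONE-PARAMETER SLOTS ARE AVERAGED LINEARLY IN THE EXPONENT: the diagonal curvature of
# the b07 carrier `barAvg` vanishes on configurations in a one-parameter subgroup (the structural half of NE1.md v7.3 R46 (a), kernel)

Cell `pub-balaban-gaps` (YM blitz Y1, track G2), seat `ne1` gen 7 (prover-pub-balaban-gaps-ne1-g7-0), record `HOME/ne/NE1.md` §4 R46 (a)
∕ R48 (v7.3) and this generation's HANDOFF.  ADDITIVE — imports the b07 lineage's `Literature/…/B7BlockAvgLog` (its carrier `barAvg`,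
`barAvg_eq_exp_sum`, `mlog_exp` — consumed BY NAME, nothing edited) ONLY.  Siblings (same generation): `TiltedMeanSmoothDualCritical`,
`TiltedMeanSmoothDualCriticalTilt`, `TiltedMeanSmoothDualSymmetry`.

WHY.  Gen 7's audit (siblings) located the curvature of the composed block averaging as a first-order-in-the-age channel unless the
slot's DISPLACEMENT is centred (symmetry) or the test function is critical, and NE1.md v7.3 R46 (a) ∕ R48 records two sizes for that
curvature: print's per-bond bound ([B7] Prop. 5 (157) p. 42, kernel `B7Prop5General.prop5_general_157`: `L^{K−j}·θ₁^{K−j}`, marginal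
letter) and the STRUCTURAL reading of [B7] (15) (`θ₁^{K−j}`, letter `L⁻¹`): «a single-bond perturbation of a flat background stays in a
one-parameter subgroup through the whole composition, so its coarse image is EXACTLY linear — the diagonal curvature vanishes —, while
the cross-bond curvature is a commutator, centred by symmetry (`TiltedMeanSmoothDualSymmetry.integral_comm_eq_zero`)».  This file makes
the FIRST half a kernel statement for the b07 lineage's carrier of Bałaban's averages — `barAvg t wt W = exp(i Σ_x wt_x (1∕i) log W_x)`,
the printed shape of [B7] (42)∕(78)∕(82)∕(110) with the base-point factor divided out (`B7BlockAvgLog` §2):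
* §1 `exp_smul_mul_exp_smul` — elements of one one-parameter subgroup multiply additively in the exponent (`exp(sC)·exp(tC) =
  exp((s+t)C)`, Mathlib `NormedSpace.exp_add_of_commute`): a contour product of such elements is again such an element, with exponent
  LINEAR in the amplitudes (`list_prod_exp_smul`).
* §2 **`barAvg_oneParameter`** — if every site variable lies in the one-parameter subgroup of `C`, `W_x = exp(s_x·C)` with
  `‖s_x·C‖ < ln 2` (the printed small-field radius of `mlog_exp`), then `barAvg t wt W = exp((Σ_x wt_x s_x)·C)`: the average stays in the
  subgroup and its exponent is the weighted SUM of the amplitudes — LINEAR; **`barAvg_oneParameter_scale`**: scaling all amplitudes by `a`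
  scales the coarse exponent by `a` — NO `a²` term: the diagonal curvature of the carrier VANISHES on one-parameter configurations;
  `barAvg_oneParameter_twoLevel`: the property is closed under iteration (two levels displayed; any number by the same lemma).
CONSEQUENCE FOR THE ROW.  The structural reading's first half is kernel FOR THE CARRIER; what stays a READING is that Bałaban's full
T-step (15) at a flat background with one excited bond reduces, contour by contour, to `barAvg` of one-parameter elements (each contour
product `U(Γ_{c,x})U(c)^{−1}` is a product of factors in `{exp(tC)}`, hence `exp((Σt)C)` by §1 — the contour systems themselves are not
modelled in the tree, `T4AvgDerivBound` DIVERGENCE F6).  The letter of the curvature channel (NE1.md R48) is unaffected as an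
implication; this file supports its `L⁻¹` reading.  Classification of NE1′ UNCHANGED: WORK-bound ∕ OBJECT-bound ∕ NOT idea-bound.

HONEST FRAMING.  [folklore] Banach-algebra calculus (`exp` of commuting elements, the b07 lineage's `mlog ∘ exp = id` on the printed
radius) over an ABSTRACT complete normed ℂ-algebra; nothing of Bałaban's beyond the SHAPE of the carrier is used; no slot, background or
contour system of his run is constructed; NE1′ NOT proved; spine 0∕9; (B) 0∕13; one fixed finite T⁴ — NOT ℝ⁴, NOT infinite volume, NOT
a mass gap, NOT Clay.  0 sorry.
-/

noncomputable section

open NormedSpace Finset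
open scoped BigOperators

namespace Summit.QuantumFields.BalabanUV.T4Continuum.NE1p.TiltedMeanOneParameter

open Literature.MathematicalPhysics.QuantumFieldTheory.Balaban1983to89.B7BlockAvgLog (barAvg barAvg_eq_exp_sum mlog_exp)
open Literature.Analysis.Complex (mem_eball_expSeries_radius)

variable {𝔸 : Type*} [NormedRing 𝔸] [NormedAlgebra ℂ 𝔸] [CompleteSpace 𝔸]

/-! ## §1 One-parameter subgroups: products are additive in the exponent -/

/-- `exp(s·C)·exp(t·C) = exp((s + t)·C)` — elements of one one-parameter subgroup commute and multiply additively in the exponent.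
[folklore] -/
theorem exp_smul_mul_exp_smul (C : 𝔸) (s t : ℝ) : exp (s • C) * exp (t • C) = exp ((s + t) • C) := by
  rw [add_smul, exp_add_of_commute_of_mem_ball (((Commute.refl C).smul_left s).smul_right t)
    (mem_eball_expSeries_radius _) (mem_eball_expSeries_radius _)]

/-- A (contour) product of elements of one one-parameter subgroup is the element with the SUM of the amplitudes: LINEAR in them.
[folklore] -/
theorem list_prod_exp_smul (C : 𝔸) (l : List ℝ) : (l.map fun t => exp (t • C)).prod = exp (l.sum • C) := by
  induction l with
  | nil => simp
  | cons t l ih => rw [List.map_cons, List.prod_cons, ih, List.sum_cons, exp_smul_mul_exp_smul]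

/-! ## §2 The b07 carrier `barAvg` on one-parameter configurations: linear in the exponent, no diagonal curvature -/

/-- **ONE-PARAMETER CONFIGURATIONS ARE AVERAGED LINEARLY IN THE EXPONENT.**  If every site variable lies in the one-parameter subgroup
generated by `C`, `W_x = exp(s_x·C)`, inside the printed logarithm radius `‖s_x·C‖ < ln 2`, then the carrier of Bałaban's block average
([B7] (42)∕(78)∕(82)∕(110), `B7BlockAvgLog.barAvg`) is `exp((Σ_x wt_x·s_x)·C)` — in the same subgroup, exponent = weighted SUM. [folklore] -/
theorem barAvg_oneParameter {ι : Type*} (t : Finset ι) (wt : ι → ℝ) (C : 𝔸) (s : ι → ℝ)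
    (hs : ∀ x ∈ t, ‖s x • C‖ < Real.log 2) :
    barAvg t wt (fun x => exp (s x • C)) = exp ((∑ x ∈ t, wt x * s x) • C) := by
  rw [barAvg_eq_exp_sum, Finset.sum_smul]
  congr 1
  refine Finset.sum_congr rfl fun x hx => ?_
  rw [mlog_exp (hs x hx), smul_smul]

/-- **NO DIAGONAL CURVATURE.**  Scaling the amplitudes of a one-parameter configuration by `a` scales the coarse exponent by `a`:
`barAvg t wt (x ↦ exp((a·s_x)·C)) = exp((a·Σ_x wt_x s_x)·C)` — the coarse variable depends on the amplitude `a` through a LINEAR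
exponent, with no `a²` term (NE1.md v7.3 R46 (a): the diagonal curvature of the averaging vanishes on one-parameter slots; the
curvature of a multi-bond slot is the commutator part, `TiltedMeanSmoothDualSymmetry` §4). [folklore] -/
theorem barAvg_oneParameter_scale {ι : Type*} (t : Finset ι) (wt : ι → ℝ) (C : 𝔸) (s : ι → ℝ) (a : ℝ)
    (hs : ∀ x ∈ t, ‖(a * s x) • C‖ < Real.log 2) :
    barAvg t wt (fun x => exp ((a * s x) • C)) = exp ((a * ∑ x ∈ t, wt x * s x) • C) := by
  rw [barAvg_oneParameter t wt C (fun x => a * s x) hs, Finset.mul_sum]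
  congr 2
  exact Finset.sum_congr rfl fun x _ => by ring

/-- **CLOSED UNDER ITERATION (two levels displayed).**  Averaging one-parameter configurations blockwise and then averaging the block
variables again stays in the subgroup with a LINEAR exponent: with inner blocks `t₁ y`, weights `wt₁ y`, amplitudes `s y x`, and outer
weights `wt₂`, `barAvg t₂ wt₂ (y ↦ barAvg (t₁ y) (wt₁ y) (x ↦ exp((s y x)·C))) = exp((Σ_y wt₂ y·Σ_x wt₁ y x·s y x)·C)` (smallness at
both levels).  Any number of levels by the same lemma. [folklore] -/
theorem barAvg_oneParameter_twoLevel {ι κ : Type*} (t₂ : Finset κ) (wt₂ : κ → ℝ) (t₁ : κ → Finset ι) (wt₁ : κ → ι → ℝ) (C : 𝔸)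
    (s : κ → ι → ℝ) (hs₁ : ∀ y ∈ t₂, ∀ x ∈ t₁ y, ‖s y x • C‖ < Real.log 2)
    (hs₂ : ∀ y ∈ t₂, ‖(∑ x ∈ t₁ y, wt₁ y x * s y x) • C‖ < Real.log 2) :
    barAvg t₂ wt₂ (fun y => barAvg (t₁ y) (wt₁ y) fun x => exp (s y x • C))
      = exp ((∑ y ∈ t₂, wt₂ y * ∑ x ∈ t₁ y, wt₁ y x * s y x) • C) := by
  have h2 : barAvg t₂ wt₂ (fun y => barAvg (t₁ y) (wt₁ y) fun x => exp (s y x • C))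
      = barAvg t₂ wt₂ (fun y => exp ((∑ x ∈ t₁ y, wt₁ y x * s y x) • C)) := by
    rw [barAvg_eq_exp_sum, barAvg_eq_exp_sum]
    congr 1
    refine Finset.sum_congr rfl fun y hy => ?_
    rw [barAvg_oneParameter (t₁ y) (wt₁ y) C (s y) (hs₁ y hy)]
  rw [h2, barAvg_oneParameter t₂ wt₂ C (fun y => ∑ x ∈ t₁ y, wt₁ y x * s y x) hs₂]

end Summit.QuantumFields.BalabanUV.T4Continuum.NE1p.TiltedMeanOneParameter

end
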